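import Mathlib
import Summits.ValiantsHypothesis.ValiantsHypothesis.Theses.NewtonUnitEquations
import Summits.ValiantsHypothesis.ValiantsHypothesis.Theorems.NewtonUnitEquationsDissociatedFixedK
import Summits.ValiantsHypothesis.ValiantsHypothesis.Theorems.NewtonUnitEquationsTwoProductsMahlerRadixRecursionDefs

/-!
# Crux `TwoProducts` (stmt-ValiantsHypothesis-5906), line `mahler-radix-recursion`: the CARRY-FREE radix regime

The registered line `Cruxes/TwoProducts/Lines/mahler-radix-recursion.lean` (NOT the item's skeleton of record) has as
its first milestone the REGIME TARGET `RadixTwoProducts`: for radix frames `f_j = D_j(X^{b^j}, Y^{b^j})` in base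
`b ≥ 2` with `t`-sparse digits of exponents `< r·b` (carry range `r`) on `m` scales,
`vert(∏_j f_j − ∏_j g_j) ≤ (m + t + r + 2)^κ`, uniformly in the base; the line derives it from its OPEN regime
engine (β_r) `stub_radixScaleStep` (`radixTwoProducts_of`; Theorems-side `radixTwoProducts_of_radixScaleStep`).

This file proves the regime target OUTRIGHT in the CARRY-FREE case `r = 1` (digit exponents `< b`; the line's own
remark "`r = 1`: no carries, the dissociated KPTT Ex. 3 digit grids"), with NO use of (β_r): carry-free radix frames
are DISSOCIATED — `Σ_j b^j e_j` determines the digit vectors `e_j ∈ [0, b)²` (uniqueness of base-`b` digits,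
`digits_eq_of_sum_eq`) — so both products live on the dissociated frame `A_j = b^j • (supp D_j ∪ supp E_j)`
(`|A_j| ≤ 2t`) and the PROVED floor of the route, `Theorems.dissociatedFixedK_proof` (crux `DissociatedFixedK`,
stmt-5907; `k = 2` products, the sign of the second carried by one digit), bounds the vertex count by
`(2mt + 2)^{C(2)} ≤ (m + t + 3)^{2 C(2)}`:

  `radixTwoProducts_carryFree : ∃ κ, ∀ b m t D E, 2 ≤ b → … digits < 1·b … → vert(∏ radix D − ∏ radix E) ≤ (m+t+1+2)^κ`

(literally the body of `RadixTwoProducts` with the carry range specialised to `r = 1`).  Reading: the regime target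
is open ONLY because of carries (`r ≥ 2`) — failure mode (i) of the line card — and a kernel calibration point for
(β_r).

Honest framing: a calibration rung on a registered non-record line; (β_r) `stub_radixScaleStep` (all `r`), (β)
`stub_hiddenVertices` and the crux `TwoProducts` are untouched and OPEN; nothing here bears on `VP ≠ VNP`.
-/

set_option linter.dupNamespace false

noncomputable section

open scoped BigOperators
open MvPolynomial

namespace Summit.ValiantsHypothesis.ValiantsHypothesis.Theorems.NewtonUnitEquations.TwoProducts.MahlerRadixRecursion

/-! ## Uniqueness of base-`b` digits -/

/-- Uniqueness of base-`b` digits: `Σ_{j<n} b^j d_j = Σ_{j<n} b^j d'_j` with all digits `< b` forces `d = d'`.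
[folklore] -/
theorem digits_eq_of_sum_eq (b : ℕ) (hb : 2 ≤ b) :
    ∀ (n : ℕ) (d d' : Fin n → ℕ), (∀ j, d j < b) → (∀ j, d' j < b) →
      ∑ j : Fin n, b ^ (j : ℕ) * d j = ∑ j : Fin n, b ^ (j : ℕ) * d' j → d = d' := by
  intro n
  induction n with
  | zero => intro d d' _ _ _; funext j; exact Fin.elim0 j
  | succ n ih =>
    intro d d' hd hd' h
    have hsplit : ∀ c : Fin (n + 1) → ℕ,
        ∑ j : Fin (n + 1), b ^ (j : ℕ) * c j = c 0 + b * ∑ j : Fin n, b ^ (j : ℕ) * c j.succ := by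
      intro c
      rw [Fin.sum_univ_succ, Finset.mul_sum]
      simp only [Fin.val_zero, pow_zero, one_mul, Fin.val_succ, pow_succ]
      congr 1
      exact Finset.sum_congr rfl fun j _ => by ring
    rw [hsplit d, hsplit d'] at h
    have h0 : d 0 = d' 0 := by
      have h1 := congrArg (· % b) h
      simp only [Nat.add_mul_mod_self_left, Nat.mod_eq_of_lt (hd 0), Nat.mod_eq_of_lt (hd' 0)] at h1
      exact h1
    have htail : (fun j : Fin n => d j.succ) = fun j => d' j.succ := by
      refine ih _ _ (fun j => hd _) (fun j => hd' _) ?_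
      have h2 : b * ∑ j : Fin n, b ^ (j : ℕ) * d j.succ = b * ∑ j : Fin n, b ^ (j : ℕ) * d' j.succ := by omega
      exact Nat.eq_of_mul_eq_mul_left (by omega) h2
    funext j
    refine Fin.cases h0 (fun j => ?_) j
    exact congrFun htail j

/-- Carry-free radix frames are DISSOCIATED: if `a_j = b^j • e_j`, `c_j = b^j • e'_j` with all digit coordinates
`< b` and `Σ a = Σ c`, then `a = c`. [folklore] -/
theorem radix_dissociated {m b : ℕ} (hb : 2 ≤ b) (e e' : Fin m → (Fin 2 →₀ ℕ)) (he : ∀ j l, e j l < b)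
    (he' : ∀ j l, e' j l < b) (h : ∑ j : Fin m, b ^ (j : ℕ) • e j = ∑ j : Fin m, b ^ (j : ℕ) • e' j) :
    e = e' := by
  funext j
  ext l
  have hl : ∑ j : Fin m, b ^ (j : ℕ) * e j l = ∑ j : Fin m, b ^ (j : ℕ) * e' j l := by
    have := congrArg (fun x : Fin 2 →₀ ℕ => x l) h
    simpa [Finsupp.finsetSum_apply, Finsupp.smul_apply, smul_eq_mul] using this
  have := digits_eq_of_sum_eq b hb m (fun j => e j l) (fun j => e' j l) (fun j => he j l) (fun j => he' j l) hl
  exact congrFun this j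

/-! ## The carry-free regime theorem -/

/-- **The radix regime target in the carry-free case, outright.**  `RadixTwoProducts` (the line's regime target)
with the carry range specialised to `r = 1` (digit exponents `< b`): for `b ≥ 2` and `t`-sparse digit polynomials
`D_j, E_j` on `m` scales, `vert(∏_j D_j(X^{b^j},Y^{b^j}) − ∏_j E_j(X^{b^j},Y^{b^j})) ≤ (m + t + 1 + 2)^κ`, uniformly in
the base — by dissociation of carry-free radix frames and the route's PROVED floor `dissociatedFixedK_proof`
(two products on one dissociated frame).  No use of the open regime engine (β_r). [folklore] -/
theorem radixTwoProducts_carryFree :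
    ∃ κ : ℕ, ∀ (b m t : ℕ) (D E : Fin m → Poly), 2 ≤ b → (∀ j, (D j).support.card ≤ t) →
      (∀ j, (E j).support.card ≤ t) → (∀ j, ∀ e ∈ (D j).support, ∀ l, e l < 1 * b) →
      (∀ j, ∀ e ∈ (E j).support, ∀ l, e l < 1 * b) →
        vert (∏ j, radix b D j - ∏ j, radix b E j) ≤ (m + t + 1 + 2) ^ κ := by
  classical
  obtain ⟨C, hC⟩ := Summit.ValiantsHypothesis.Theorems.dissociatedFixedK_proof 2
  refine ⟨2 * C, fun b m t D E hb hD hE hDd hEd => ?_⟩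
  -- `m = 0`: the difference is `1 − 1 = 0`
  rcases Nat.eq_zero_or_pos m with hm | hm
  · subst hm
    have h0 : (∏ j, radix b D j - ∏ j, radix b E j : Poly) = 0 := by simp
    have hv : vert (0 : Poly) = 0 := by
      change (Set.extremePoints ℝ (convexHull ℝ (ι '' ((0 : Poly).support : Set (Fin 2 →₀ ℕ))))).ncard = 0
      rw [support_zero, Finset.coe_empty, Set.image_empty, convexHull_empty]
      simp
    rw [h0, hv]
    exact Nat.zero_le _
  -- `m ≥ 1`: put the sign on the digit `E 0`
  set j₀ : Fin m := ⟨0, hm⟩ with hj₀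
  set E' : Fin m → Poly := Function.update E j₀ (-E j₀) with hE'
  have hE'supp : ∀ j, (E' j).support = (E j).support := by
    intro j
    by_cases hj : j = j₀
    · subst hj; rw [hE', Function.update_self, support_neg]
    · rw [hE', Function.update_of_ne hj]
  have hprodE' : ∏ j, radix b E' j = -∏ j, radix b E j := by
    have hupd : radix b E' = Function.update (radix b E) j₀ (-radix b E j₀) := by
      funext j
      by_cases hj : j = j₀
      · subst hj; simp [radix, hE']
      · simp [radix, hE', Function.update_of_ne hj]
    rw [hupd, Finset.prod_update_of_mem (Finset.mem_univ j₀), Finset.sdiff_singleton_eq_erase,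
      neg_mul, Finset.mul_prod_erase _ _ (Finset.mem_univ j₀)]
  -- the two products as a `k = 2` family on the dissociated frame `A_j = b^j • (supp D_j ∪ supp E_j)`
  set f : Fin 2 → Fin m → Poly := ![radix b D, radix b E'] with hf
  set A : Fin m → Finset (Fin 2 →₀ ℕ) := fun j => ((D j).support ∪ (E j).support).image (b ^ (j : ℕ) • ·)
    with hA
  have hsum : ∑ i, ∏ j, f i j = ∏ j, radix b D j - ∏ j, radix b E j := by
    rw [Fin.sum_univ_two]
    simp only [hf, Matrix.cons_val_zero, Matrix.cons_val_one, Matrix.cons_val_fin_one]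
    rw [hprodE', sub_eq_add_neg]
  have hAcard : ∀ j, (A j).card ≤ 2 * t := fun j =>
    Finset.card_image_le.trans ((Finset.card_union_le _ _).trans (by linarith [hD j, hE j]))
  have hfA : ∀ i j, (f i j).support ⊆ A j := by
    intro i j
    fin_cases i
    · change (expand (b ^ (j : ℕ)) (D j)).support ⊆ A j
      exact (support_expand_subset (D j)).trans (Finset.image_subset_image Finset.subset_union_left)
    · change (expand (b ^ (j : ℕ)) (E' j)).support ⊆ A j
      refine (support_expand_subset (E' j)).trans ?_
      rw [hE'supp j]
      exact Finset.image_subset_image Finset.subset_union_right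
  have hdiss : ∀ a c : Fin m → (Fin 2 →₀ ℕ), (∀ j, a j ∈ A j) → (∀ j, c j ∈ A j) →
      ∑ j, a j = ∑ j, c j → a = c := by
    intro a c ha hc hac
    have ha' : ∀ j, ∃ e ∈ (D j).support ∪ (E j).support, b ^ (j : ℕ) • e = a j :=
      fun j => by simpa [hA, Finset.mem_image] using ha j
    have hc' : ∀ j, ∃ e ∈ (D j).support ∪ (E j).support, b ^ (j : ℕ) • e = c j :=
      fun j => by simpa [hA, Finset.mem_image] using hc j
    choose e he hea using ha'
    choose e' he' hec using hc'
    have hdig : ∀ (g : Fin m → (Fin 2 →₀ ℕ)), (∀ j, g j ∈ (D j).support ∪ (E j).support) → ∀ j l, g j l < b := by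
      intro g hg j l
      rcases Finset.mem_union.mp (hg j) with h | h
      · simpa using hDd j (g j) h l
      · simpa using hEd j (g j) h l
    have hee : e = e' := by
      refine radix_dissociated hb e e' (hdig e he) (hdig e' he') ?_
      calc ∑ j : Fin m, b ^ (j : ℕ) • e j = ∑ j, a j := Finset.sum_congr rfl fun j _ => hea j
        _ = ∑ j, c j := hac
        _ = ∑ j : Fin m, b ^ (j : ℕ) • e' j := Finset.sum_congr rfl fun j _ => (hec j).symm
    funext j
    rw [← hea j, ← hec j, hee]
  have hfloor := hC m (2 * t) A f hAcard hfA hdiss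
  rw [hsum] at hfloor
  -- `(m·2t + 2)^C ≤ (m + t + 3)^(2C)`
  have harith : (m * (2 * t) + 2) ^ C ≤ (m + t + 1 + 2) ^ (2 * C) := by
    rw [pow_mul]
    exact Nat.pow_le_pow_left (by nlinarith) C
  exact hfloor.trans harith

end Summit.ValiantsHypothesis.ValiantsHypothesis.Theorems.NewtonUnitEquations.TwoProducts.MahlerRadixRecursion

end
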